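import Mathlib
import Summits.ValiantsHypothesis.ValiantsHypothesis.Theorems.RigidityForcesSymmetryRankRigidMinimalReprLaplaceFiveSeparatedCaptureJointProlongation
import Summits.ValiantsHypothesis.ValiantsHypothesis.Theorems.RigidityForcesSymmetryRankRigidMinimalReprLaplaceFiveSeparatedCaptureTwoEqualPlusLineTools
import Summits.ValiantsHypothesis.ValiantsHypothesis.Theorems.RigidityForcesSymmetryRankRigidMinimalReprLaplaceFiveSeparatedCaptureSpanTools

/-!
# ValiantsHypothesis / RigidityForcesSymmetry — crux `LaplaceOptimalFive` (stmt-ValiantsHypothesis-24813), symmetric capture (SC):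
# ★ **COORDINATE SLICES: a span that does not involve a letter `c` forces the `c`-slice of every obligation into the joint span**,
# the TWO-SLICE COUNT `finrank W ≤ finrank Y₁ + finrank Y₂ + 1`, and ★★ `(SC)` FOR A PAIR-SUPPORTED LINE IN A 3-SPACE
# (in particular the equal-lines profile `(ℂx_ab, ℂx_ab, V)`, `x_ab ∈ V`, `finrank V = 3` — a sub-case of `(1,1,3)`)

From the joint-prolongation residue (✓ `sub_symPlaced_mem_prolong`): `P₅⌞μ = 3·Sym(A) + G` with `G ∈ prolong X`,
`X = U₀₁ ⊔ U₀₂ ⊔ U₁₂`.  If the span `U₀₁` does not involve the letter `c` (every matrix of `U₀₁` has zero row `c`), the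
`c`-slice of `3·Sym(A)` is just `A_c`, so the `c`-SLICE `(p,q) ↦ (P₅⌞μ)(p,q,c)` LIES IN `X` (`sliceCoord_mem_01/02/12`).  Two such
letters `c₁ ≠ c₂` give a linear map `μ ↦ (slice_{c₁}, slice_{c₂})` on `W` whose kernel is at most a line (an obligation killed on both
slices is a multiple of the single word on the three remaining letters; ✓ `vanish_of_offpair_support`, ✓ `hub_injective`), whence
`finrank W ≤ finrank Y₁ + finrank Y₂ + 1` for any `Y_i` containing the slices (`finrank_le_of_two_slices`).  For a line `ℂu` with `u`
supported on a pair of letters `{a,b}` (e.g. the pair monomial `x_ab`, or any `αx_aa + βx_ab + γx_bb`) inside a joint span `X` of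
`finrank ≤ 3`, the three slices at the other letters lie in `X ∩ Z_c` (symmetric, zero-diagonal, row `c` zero), the triple intersection of
the `X ∩ Z_{c_i}` is at most the line `ℂ(x_ab)`, so two of them have total finrank `≤ 4` (`exists_pair_finrank_add_le_four`) and
★★ `finrank W ≤ 5` (`finrank_le_five_of_pairLine_flat`); as `(SC)`: ★★ `captureIneqSym_of_pairLine_mem_three` for `(ℂu, ℂu, V)`, `u ∈ V`
pair-supported, `finrank V = 3` — the pair-monomial sub-case of the LAST open sub-case of the profile `(1,1,3)` (val-lit-p6 g19 bus
13:59:57Z; the sub-cases «`u` with a diagonal entry» / «zero-diagonal with ≥ 3 rows» are EqualPencil bookkeeping, filed separately).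

Honest framing.  Sub-cases/tools for an OPEN inequality: `CaptureIneqSym` in general, K1 on `K₃ ⊔ K₂`, S2′, `LaplaceOptimalFive`
(stmt-24813, OPEN · CONTESTED 72/120), `RankRigidMinimalRepr`, `VP ≠ VNP` are NOT proved.  No definitions, no `sorry`; Mathlib + tree only.
-/

set_option linter.dupNamespace false
set_option autoImplicit false

namespace Summit.ValiantsHypothesis.ValiantsHypothesis.Theorems.RigidityForcesSymmetryRankRigidMinimalRepr

namespace LaplaceFiveSeparatedCapture

open Finset

/-! ### Coordinate slices of an obligation lie in the joint span when one span avoids the letter -/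

/-- A slice of an element of the prolongation lies in the space (slice in the LAST index). [folklore] -/
theorem slice_last_mem_of_mem_prolong (X : Submodule ℂ (Fin 5 → Fin 5 → ℂ)) {G : Fin 5 → Fin 5 → Fin 5 → ℂ}
    (hG : G ∈ prolong X) (c : Fin 5) : (fun p q => G p q c) ∈ X := by
  obtain ⟨h12, h23, hsl⟩ := (mem_prolong_iff X G).mp hG
  have e : (fun p q => G p q c) = G c := by
    funext p q
    show G p q c = G c p q
    rw [h23 p q c, h12 p c q]
  rw [e]; exact hsl c

/-- ★ **COORDINATE SLICE, slot `01`.**  If no matrix of `U₀₁` involves the letter `c` (row `c` vanishes), then the `c`-slice of every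
obligation captured by `L3 U₀₁ U₀₂ U₁₂` lies in `U₀₁ ⊔ U₀₂ ⊔ U₁₂`. [folklore] -/
theorem sliceCoord_mem_01 (U01 U02 U12 : Submodule ℂ (Fin 5 → Fin 5 → ℂ))
    (h01 : ∀ x ∈ U01, ∀ p q : Fin 5, x p q = x q p) (h02 : ∀ x ∈ U02, ∀ p q : Fin 5, x p q = x q p)
    (h12 : ∀ x ∈ U12, ∀ p q : Fin 5, x p q = x q p) (c : Fin 5) (hrow : ∀ x ∈ U01, ∀ q : Fin 5, x c q = 0)
    (μ : Fin 5 → Fin 5 → ℂ) (hμ : contractZ μ ∈ L3 U01 U02 U12) :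
    (fun p q => contractZ μ p q c) ∈ U01 ⊔ U02 ⊔ U12 := by
  obtain ⟨A, B, C, hA, hB, hC, hT⟩ := L3_finite_form U01 U02 U12 hμ
  have hres := (sub_symPlaced_mem_prolong U01 U02 U12 A B C (contractZ μ) hA hB hC
    (fun r p q => h01 _ (hA r) p q) (fun r p q => h02 _ (hB r) p q) (fun r p q => h12 _ (hC r) p q) hT
    (fun p q r => contractZ_swap12 μ p q r) (fun p q r => contractZ_swap23 μ p q r)).2.2
  have hsl := slice_last_mem_of_mem_prolong _ hres c
  have e : (fun p q => contractZ μ p q c)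
      = (fun p q => (contractZ μ - fun p q r => A r p q + A q p r + A p q r) p q c) + A c := by
    funext p q
    simp only [Pi.add_apply, Pi.sub_apply]
    have h1 : A q p c = 0 := by rw [h01 _ (hA q) p c]; exact hrow _ (hA q) p
    have h2 : A p q c = 0 := by rw [h01 _ (hA p) q c]; exact hrow _ (hA p) q
    rw [h1, h2]; ring
  rw [e]
  exact Submodule.add_mem _ hsl (Submodule.mem_sup_left (Submodule.mem_sup_left (hA c)))

/-- ★ **COORDINATE SLICE, slot `02`.** [folklore] -/
theorem sliceCoord_mem_02 (U01 U02 U12 : Submodule ℂ (Fin 5 → Fin 5 → ℂ))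
    (h01 : ∀ x ∈ U01, ∀ p q : Fin 5, x p q = x q p) (h02 : ∀ x ∈ U02, ∀ p q : Fin 5, x p q = x q p)
    (h12 : ∀ x ∈ U12, ∀ p q : Fin 5, x p q = x q p) (c : Fin 5) (hrow : ∀ x ∈ U02, ∀ q : Fin 5, x c q = 0)
    (μ : Fin 5 → Fin 5 → ℂ) (hμ : contractZ μ ∈ L3 U01 U02 U12) :
    (fun p q => contractZ μ p q c) ∈ U01 ⊔ U02 ⊔ U12 := by
  obtain ⟨A, B, C, hA, hB, hC, hT⟩ := L3_finite_form U01 U02 U12 hμ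
  have hres := (sub_symPlaced_mem_prolong U01 U02 U12 A B C (contractZ μ) hA hB hC
    (fun r p q => h01 _ (hA r) p q) (fun r p q => h02 _ (hB r) p q) (fun r p q => h12 _ (hC r) p q) hT
    (fun p q r => contractZ_swap12 μ p q r) (fun p q r => contractZ_swap23 μ p q r)).2.1
  have hsl := slice_last_mem_of_mem_prolong _ hres c
  have e : (fun p q => contractZ μ p q c)
      = (fun p q => (contractZ μ - fun p q r => B r p q + B q p r + B p q r) p q c) + B c := by
    funext p q
    simp only [Pi.add_apply, Pi.sub_apply]
    have h1 : B q p c = 0 := by rw [h02 _ (hB q) p c]; exact hrow _ (hB q) p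
    have h2 : B p q c = 0 := by rw [h02 _ (hB p) q c]; exact hrow _ (hB p) q
    rw [h1, h2]; ring
  rw [e]
  exact Submodule.add_mem _ hsl (Submodule.mem_sup_left (Submodule.mem_sup_right (hB c)))

/-- ★ **COORDINATE SLICE, slot `12`.** [folklore] -/
theorem sliceCoord_mem_12 (U01 U02 U12 : Submodule ℂ (Fin 5 → Fin 5 → ℂ))
    (h01 : ∀ x ∈ U01, ∀ p q : Fin 5, x p q = x q p) (h02 : ∀ x ∈ U02, ∀ p q : Fin 5, x p q = x q p)
    (h12 : ∀ x ∈ U12, ∀ p q : Fin 5, x p q = x q p) (c : Fin 5) (hrow : ∀ x ∈ U12, ∀ q : Fin 5, x c q = 0)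
    (μ : Fin 5 → Fin 5 → ℂ) (hμ : contractZ μ ∈ L3 U01 U02 U12) :
    (fun p q => contractZ μ p q c) ∈ U01 ⊔ U02 ⊔ U12 := by
  obtain ⟨A, B, C, hA, hB, hC, hT⟩ := L3_finite_form U01 U02 U12 hμ
  have hres := (sub_symPlaced_mem_prolong U01 U02 U12 A B C (contractZ μ) hA hB hC
    (fun r p q => h01 _ (hA r) p q) (fun r p q => h02 _ (hB r) p q) (fun r p q => h12 _ (hC r) p q) hT
    (fun p q r => contractZ_swap12 μ p q r) (fun p q r => contractZ_swap23 μ p q r)).1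
  have hsl := slice_last_mem_of_mem_prolong _ hres c
  have e : (fun p q => contractZ μ p q c)
      = (fun p q => (contractZ μ - fun p q r => C r p q + C q p r + C p q r) p q c) + C c := by
    funext p q
    simp only [Pi.add_apply, Pi.sub_apply]
    have h1 : C q p c = 0 := by rw [h12 _ (hC q) p c]; exact hrow _ (hC q) p
    have h2 : C p q c = 0 := by rw [h12 _ (hC p) q c]; exact hrow _ (hC p) q
    rw [h1, h2]; ring
  rw [e]
  exact Submodule.add_mem _ hsl (Submodule.mem_sup_right (hC c))

/-! ### The two-slice count -/

/-- An obligation killed on the slices of two letters `c₁, c₂` and at the word of the three remaining letters vanishes. [folklore] -/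
theorem contractZ_eq_zero_of_two_slices (μ : Fin 5 → Fin 5 → ℂ) (c₁ c₂ a b e : Fin 5)
    (hcov : ∀ x : Fin 5, x = c₁ ∨ x = c₂ ∨ x = a ∨ x = b ∨ x = e)
    (h1 : ∀ p q, contractZ μ p q c₁ = 0) (h2 : ∀ p q, contractZ μ p q c₂ = 0) (h0 : contractZ μ a b e = 0) :
    contractZ μ = 0 := by
  have s12 : ∀ p q r, contractZ μ p q r = contractZ μ q p r := fun p q r => (contractZ_swap12 μ p q r).symm
  have s23 : ∀ p q r, contractZ μ p q r = contractZ μ p r q := fun p q r => (contractZ_swap23 μ p q r).symm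
  have s13 : ∀ p q r, contractZ μ p q r = contractZ μ r q p := fun p q r => by rw [s12, s23, s12]
  -- vanishing as soon as one letter is `c₁` or `c₂`
  have hc : ∀ p q r, (r = c₁ ∨ r = c₂) → contractZ μ p q r = 0 := by
    rintro p q r (rfl | rfl)
    · exact h1 p q
    · exact h2 p q
  funext p q r
  refine vanish_of_offpair_support (contractZ μ) s12 s23 (contractZ_rep12 μ) a b (fun k => ?_) (fun p q r hpa hpb hqa hqb => ?_)
    p q r
  · rcases hcov k with hk | hk | rfl | rfl | rfl
    · exact hc a b k (Or.inl hk)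
    · exact hc a b k (Or.inr hk)
    · rw [s23]; exact contractZ_rep12 μ k b
    · rw [s13]; exact contractZ_rep12 μ k a
    · exact h0
  · rcases hcov p with hp | hp | hp | hp | hp
    · rw [s13]; exact hc r q p (Or.inl hp)
    · rw [s13]; exact hc r q p (Or.inr hp)
    · exact absurd hp hpa
    · exact absurd hp hpb
    rcases hcov q with hq | hq | hq | hq | hq
    · rw [s23]; exact hc p r q (Or.inl hq)
    · rw [s23]; exact hc p r q (Or.inr hq)
    · exact absurd hq hqa
    · exact absurd hq hqb
    rw [hp, hq]; exact contractZ_rep12 μ e r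

/-- ★ **TWO-SLICE COUNT.**  If the `c₁`- and `c₂`-slices of every obligation of `W` lie in subspaces `Y₁, Y₂`, then
`finrank W ≤ finrank Y₁ + finrank Y₂ + 1` (the letters `c₁, c₂, a, b, e` exhaust `Fin 5`). [folklore] -/
theorem finrank_le_of_two_slices (W : Submodule ℂ (Fin 5 → Fin 5 → ℂ))
    (hWs : ∀ μ ∈ W, ∀ s t : Fin 5, μ s t = μ t s) (hWd : ∀ μ ∈ W, ∀ s : Fin 5, μ s s = 0)
    (c₁ c₂ a b e : Fin 5) (hcov : ∀ x : Fin 5, x = c₁ ∨ x = c₂ ∨ x = a ∨ x = b ∨ x = e)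
    (Y₁ Y₂ : Submodule ℂ (Fin 5 → Fin 5 → ℂ))
    (hY₁ : ∀ μ ∈ W, (fun p q => contractZ μ p q c₁) ∈ Y₁) (hY₂ : ∀ μ ∈ W, (fun p q => contractZ μ p q c₂) ∈ Y₂) :
    Module.finrank ℂ W ≤ Module.finrank ℂ Y₁ + Module.finrank ℂ Y₂ + 1 := by
  classical
  let sl : Fin 5 → ((Fin 5 → Fin 5 → Fin 5 → ℂ) →ₗ[ℂ] (Fin 5 → Fin 5 → ℂ)) := fun c =>
    { toFun := fun T p q => T p q c, map_add' := fun _ _ => rfl, map_smul' := fun _ _ => rfl }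
  let Ψ : W →ₗ[ℂ] (Fin 5 → Fin 5 → ℂ) × (Fin 5 → Fin 5 → ℂ) :=
    (LinearMap.prod ((sl c₁).comp cZ) ((sl c₂).comp cZ)).domRestrict W
  have hΨ : ∀ μ : W, Ψ μ = ((fun p q => contractZ μ.1 p q c₁), (fun p q => contractZ μ.1 p q c₂)) := fun μ => rfl
  -- range
  have hrange : LinearMap.range Ψ ≤ Y₁.prod Y₂ := by
    rintro _ ⟨μ, rfl⟩
    rw [hΨ]
    exact ⟨hY₁ μ.1 μ.2, hY₂ μ.1 μ.2⟩
  have hr : Module.finrank ℂ (LinearMap.range Ψ) ≤ Module.finrank ℂ Y₁ + Module.finrank ℂ Y₂ := by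
    refine (Submodule.finrank_mono hrange).trans ?_
    rw [LinearMap.prod_eq_sup_map]
    exact (Submodule.finrank_add_le_finrank_add_finrank _ _).trans
      (add_le_add (Submodule.finrank_map_le _ _) (Submodule.finrank_map_le _ _))
  -- kernel: at most a line, read off at the word `(a, b, e)`
  let ev : (Fin 5 → Fin 5 → Fin 5 → ℂ) →ₗ[ℂ] ℂ :=
    (LinearMap.proj e : (Fin 5 → ℂ) →ₗ[ℂ] ℂ).comp
      ((LinearMap.proj b : (Fin 5 → Fin 5 → ℂ) →ₗ[ℂ] (Fin 5 → ℂ)).comp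
        (LinearMap.proj a : (Fin 5 → Fin 5 → Fin 5 → ℂ) →ₗ[ℂ] (Fin 5 → Fin 5 → ℂ)))
  let ρ : (LinearMap.ker Ψ) →ₗ[ℂ] ℂ := ev.comp (cZ.comp (W.subtype.comp (LinearMap.ker Ψ).subtype))
  have hρa : ∀ x : LinearMap.ker Ψ, ρ x = contractZ (x.1.1 : Fin 5 → Fin 5 → ℂ) a b e := fun x => rfl
  have hρ : Function.Injective ρ := by
    rw [injective_iff_map_eq_zero]
    intro x hx
    rw [hρa] at hx
    have hker : Ψ x.1 = 0 := LinearMap.mem_ker.mp x.2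
    rw [hΨ, Prod.mk_eq_zero] at hker
    have h1 : ∀ p q, contractZ (x.1.1 : Fin 5 → Fin 5 → ℂ) p q c₁ = 0 := fun p q => congrFun (congrFun hker.1 p) q
    have h2 : ∀ p q, contractZ (x.1.1 : Fin 5 → Fin 5 → ℂ) p q c₂ = 0 := fun p q => congrFun (congrFun hker.2 p) q
    have hT := contractZ_eq_zero_of_two_slices x.1.1 c₁ c₂ a b e hcov h1 h2 hx
    have hμ : (x.1.1 : Fin 5 → Fin 5 → ℂ) = 0 :=
      hub_injective x.1.1 (hWs _ x.1.2) (hWd _ x.1.2) (fun p q => by simp [hT])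
    exact Subtype.ext (Subtype.ext hμ)
  have hk : Module.finrank ℂ (LinearMap.ker Ψ) ≤ 1 := by
    have := LinearMap.finrank_le_finrank_of_injective hρ
    simpa using this
  have hrn := LinearMap.finrank_range_add_finrank_ker Ψ
  omega

/-! ### Two of three subspaces of a 3-space with small triple intersection have total finrank ≤ 4 -/

/-- Three subspaces `A₁, A₂, A₃` of a space `V` with `finrank V ≤ 3` and `finrank (A₁ ⊓ A₂ ⊓ A₃) ≤ 1`: two of them have total
finrank `≤ 4`. [folklore] -/
theorem exists_pair_finrank_add_le_four (V A₁ A₂ A₃ : Submodule ℂ (Fin 5 → Fin 5 → ℂ))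
    (h₁ : A₁ ≤ V) (h₂ : A₂ ≤ V) (h₃ : A₃ ≤ V) (hV : Module.finrank ℂ V ≤ 3)
    (hint : Module.finrank ℂ (A₁ ⊓ A₂ ⊓ A₃ : Submodule ℂ (Fin 5 → Fin 5 → ℂ)) ≤ 1) :
    Module.finrank ℂ A₁ + Module.finrank ℂ A₂ ≤ 4 ∨ Module.finrank ℂ A₁ + Module.finrank ℂ A₃ ≤ 4 ∨
      Module.finrank ℂ A₂ + Module.finrank ℂ A₃ ≤ 4 := by
  have d₁ := Submodule.finrank_mono h₁
  have d₂ := Submodule.finrank_mono h₂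
  have d₃ := Submodule.finrank_mono h₃
  by_contra h
  push Not at h
  -- two of the three subspaces are all of `V`
  have full : ∀ {B : Submodule ℂ (Fin 5 → Fin 5 → ℂ)}, B ≤ V → Module.finrank ℂ V ≤ Module.finrank ℂ B → B = V :=
    fun hB hd => Submodule.eq_of_le_of_finrank_le hB hd
  rcases (by omega : (Module.finrank ℂ V ≤ Module.finrank ℂ A₁ ∧ Module.finrank ℂ V ≤ Module.finrank ℂ A₂) ∨
      (Module.finrank ℂ V ≤ Module.finrank ℂ A₁ ∧ Module.finrank ℂ V ≤ Module.finrank ℂ A₃) ∨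
      (Module.finrank ℂ V ≤ Module.finrank ℂ A₂ ∧ Module.finrank ℂ V ≤ Module.finrank ℂ A₃)) with ⟨e, e'⟩ | ⟨e, e'⟩ | ⟨e, e'⟩
  · have hA : A₁ ⊓ A₂ ⊓ A₃ = A₃ := by
      rw [full h₁ e, full h₂ e', inf_idem, inf_eq_right.mpr h₃]
    rw [hA] at hint; omega
  · have hA : A₁ ⊓ A₂ ⊓ A₃ = A₂ := by
      rw [full h₁ e, full h₃ e', inf_eq_right.mpr h₂, inf_eq_left.mpr h₂]
    rw [hA] at hint; omega
  · have hA : A₁ ⊓ A₂ ⊓ A₃ = A₁ := by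
      rw [full h₂ e, full h₃ e', inf_eq_left.mpr h₁, inf_eq_left.mpr h₁]
    rw [hA] at hint; omega

/-! ### A pair-supported line inside a 3-space -/

/-- ★★ **PAIR-SUPPORTED LINE IN A 3-SPACE: `finrank W ≤ 5`.**  `U₀₁ = ℂu` with `u` supported on the letters `{a, b}` (`a ≠ b`;
e.g. `u = x_ab`), `U₀₂, U₁₂` symmetric, and the joint span `ℂu ⊔ U₀₂ ⊔ U₁₂` of `finrank ≤ 3`: every captured `W` has `finrank W ≤ 5`. [folklore] -/
theorem finrank_le_five_of_pairLine_flat (u : Fin 5 → Fin 5 → ℂ) (hu : ∀ p q, u p q = u q p)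
    (a b c₁ c₂ c₃ : Fin 5) (hcov : ∀ x : Fin 5, x = a ∨ x = b ∨ x = c₁ ∨ x = c₂ ∨ x = c₃)
    (hc₁ : c₁ ≠ a ∧ c₁ ≠ b) (hc₂ : c₂ ≠ a ∧ c₂ ≠ b) (hc₃ : c₃ ≠ a ∧ c₃ ≠ b)
    (hsupp : ∀ p q, u p q ≠ 0 → (p = a ∨ p = b) ∧ (q = a ∨ q = b))
    (U02 U12 W : Submodule ℂ (Fin 5 → Fin 5 → ℂ))
    (h02 : ∀ x ∈ U02, ∀ p q : Fin 5, x p q = x q p) (h12 : ∀ x ∈ U12, ∀ p q : Fin 5, x p q = x q p)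
    (hX : Module.finrank ℂ ((ℂ ∙ u) ⊔ U02 ⊔ U12 : Submodule ℂ (Fin 5 → Fin 5 → ℂ)) ≤ 3)
    (hWs : ∀ μ ∈ W, ∀ s t : Fin 5, μ s t = μ t s) (hWd : ∀ μ ∈ W, ∀ s : Fin 5, μ s s = 0)
    (hWc : ∀ μ ∈ W, contractZ μ ∈ L3 (ℂ ∙ u) U02 U12) :
    Module.finrank ℂ W ≤ 5 := by
  classical
  set X : Submodule ℂ (Fin 5 → Fin 5 → ℂ) := (ℂ ∙ u) ⊔ U02 ⊔ U12 with hXdef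
  have h01 : ∀ x ∈ (ℂ ∙ u), ∀ p q : Fin 5, x p q = x q p := by
    intro x hx p q
    obtain ⟨s, rfl⟩ := Submodule.mem_span_singleton.mp hx
    simp only [Pi.smul_apply, smul_eq_mul, hu p q]
  -- rows of `u` at the three other letters vanish
  have hrow : ∀ c : Fin 5, c ≠ a ∧ c ≠ b → ∀ x ∈ (ℂ ∙ u), ∀ q : Fin 5, x c q = 0 := by
    rintro c ⟨hca, hcb⟩ x hx q
    obtain ⟨s, rfl⟩ := Submodule.mem_span_singleton.mp hx
    simp only [Pi.smul_apply, smul_eq_mul]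
    by_cases h0 : u c q = 0
    · rw [h0, mul_zero]
    · rcases (hsupp c q h0).1 with h | h
      · exact absurd h hca
      · exact absurd h hcb
  -- the zero pattern of a `c`-slice: symmetric, zero diagonal, row `c` zero
  let E : Fin 5 → Fin 5 → ((Fin 5 → Fin 5 → ℂ) →ₗ[ℂ] ℂ) := fun p q =>
    (LinearMap.proj q : (Fin 5 → ℂ) →ₗ[ℂ] ℂ).comp (LinearMap.proj p : (Fin 5 → Fin 5 → ℂ) →ₗ[ℂ] (Fin 5 → ℂ))
  have hE : ∀ p q (M : Fin 5 → Fin 5 → ℂ), E p q M = M p q := fun _ _ _ => rfl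
  let Z : Fin 5 → Submodule ℂ (Fin 5 → Fin 5 → ℂ) := fun c =>
    (⨅ q, LinearMap.ker (E c q)) ⊓ (⨅ q, LinearMap.ker (E q q)) ⊓ (⨅ p, ⨅ q, LinearMap.ker (E p q - E q p))
  have hZ : ∀ c (M : Fin 5 → Fin 5 → ℂ), M ∈ Z c ↔ (∀ q, M c q = 0) ∧ (∀ q, M q q = 0) ∧ (∀ p q, M p q = M q p) := by
    intro c M
    simp only [Z, Submodule.mem_inf, Submodule.mem_iInf, LinearMap.mem_ker, LinearMap.sub_apply, hE, sub_eq_zero, and_assoc]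
  -- every `c`-slice lies in `X ⊓ Z c` (for `c` off the pair)
  have hslice : ∀ c : Fin 5, c ≠ a ∧ c ≠ b → ∀ μ ∈ W, (fun p q => contractZ μ p q c) ∈ X ⊓ Z c := by
    intro c hc μ hμ
    refine Submodule.mem_inf.mpr ⟨sliceCoord_mem_01 (ℂ ∙ u) U02 U12 h01 h02 h12 c (hrow c hc) μ (hWc μ hμ), ?_⟩
    refine (hZ c _).mpr ⟨fun q => ?_, fun q => ?_, fun p q => ?_⟩
    · show contractZ μ c q c = 0
      rw [← contractZ_swap23, ← contractZ_swap12]; exact contractZ_rep12 μ c q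
    · exact contractZ_rep12 μ q c
    · exact (contractZ_swap12 μ q p c)
  -- the triple intersection is at most the line `ℂ(e_ab + e_ba)`
  let m : Fin 5 → Fin 5 → ℂ := fun p q => if (p = a ∧ q = b) ∨ (p = b ∧ q = a) then 1 else 0
  have htriple : X ⊓ Z c₁ ⊓ (X ⊓ Z c₂) ⊓ (X ⊓ Z c₃) ≤ ℂ ∙ m := by
    intro M hM
    obtain ⟨⟨hM1, hM2⟩, hM3⟩ := Submodule.mem_inf.mp hM
    obtain ⟨-, hz1⟩ := Submodule.mem_inf.mp hM1
    obtain ⟨-, hz2⟩ := Submodule.mem_inf.mp hM2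
    obtain ⟨-, hz3⟩ := Submodule.mem_inf.mp hM3
    obtain ⟨r1, hd, hs⟩ := (hZ c₁ M).mp hz1
    obtain ⟨r2, -, -⟩ := (hZ c₂ M).mp hz2
    obtain ⟨r3, -, -⟩ := (hZ c₃ M).mp hz3
    have hoff : ∀ p q, ¬((p = a ∧ q = b) ∨ (p = b ∧ q = a)) → M p q = 0 := by
      intro p q hpq
      rcases hcov p with hp | hp | hp | hp | hp
      · rcases hcov q with hq | hq | hq | hq | hq
        · rw [hp, hq]; exact hd a
        · exact absurd (Or.inl ⟨hp, hq⟩) hpq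
        · rw [hs p q, hq]; exact r1 p
        · rw [hs p q, hq]; exact r2 p
        · rw [hs p q, hq]; exact r3 p
      · rcases hcov q with hq | hq | hq | hq | hq
        · exact absurd (Or.inr ⟨hp, hq⟩) hpq
        · rw [hp, hq]; exact hd b
        · rw [hs p q, hq]; exact r1 p
        · rw [hs p q, hq]; exact r2 p
        · rw [hs p q, hq]; exact r3 p
      · rw [hp]; exact r1 q
      · rw [hp]; exact r2 q
      · rw [hp]; exact r3 q
    refine Submodule.mem_span_singleton.mpr ⟨M a b, ?_⟩
    funext p q
    simp only [Pi.smul_apply, smul_eq_mul, m]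
    by_cases hpq : (p = a ∧ q = b) ∨ (p = b ∧ q = a)
    · rw [if_pos hpq, mul_one]
      rcases hpq with ⟨hp, hq⟩ | ⟨hp, hq⟩
      · rw [hp, hq]
      · rw [hp, hq]; exact hs a b
    · rw [if_neg hpq, mul_zero, hoff p q hpq]
  have hint : Module.finrank ℂ (X ⊓ Z c₁ ⊓ (X ⊓ Z c₂) ⊓ (X ⊓ Z c₃) : Submodule ℂ (Fin 5 → Fin 5 → ℂ)) ≤ 1 :=
    (Submodule.finrank_mono htriple).trans ((finrank_span_le_card ({m} : Set (Fin 5 → Fin 5 → ℂ))).trans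
      (by rw [Set.toFinset_singleton, Finset.card_singleton]))
  -- two of the three slice spaces have total finrank ≤ 4; count with the two-slice map
  have hcov' : ∀ x : Fin 5, x = c₁ ∨ x = c₂ ∨ x = a ∨ x = b ∨ x = c₃ := fun x => by
    rcases hcov x with h | h | h | h | h
    · exact Or.inr (Or.inr (Or.inl h))
    · exact Or.inr (Or.inr (Or.inr (Or.inl h)))
    · exact Or.inl h
    · exact Or.inr (Or.inl h)
    · exact Or.inr (Or.inr (Or.inr (Or.inr h)))
  rcases exists_pair_finrank_add_le_four X (X ⊓ Z c₁) (X ⊓ Z c₂) (X ⊓ Z c₃) inf_le_left inf_le_left inf_le_left hX hint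
    with h | h | h
  · have := finrank_le_of_two_slices W hWs hWd c₁ c₂ a b c₃ hcov' (X ⊓ Z c₁) (X ⊓ Z c₂)
      (fun μ hμ => hslice c₁ hc₁ μ hμ) (fun μ hμ => hslice c₂ hc₂ μ hμ)
    omega
  · have := finrank_le_of_two_slices W hWs hWd c₁ c₃ a b c₂
      (fun x => by rcases hcov' x with h | h | h | h | h <;> simp [h]) (X ⊓ Z c₁) (X ⊓ Z c₃)
      (fun μ hμ => hslice c₁ hc₁ μ hμ) (fun μ hμ => hslice c₃ hc₃ μ hμ)
    omega
  · have := finrank_le_of_two_slices W hWs hWd c₂ c₃ a b c₁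
      (fun x => by rcases hcov' x with h | h | h | h | h <;> simp [h]) (X ⊓ Z c₂) (X ⊓ Z c₃)
      (fun μ hμ => hslice c₂ hc₂ μ hμ) (fun μ hμ => hslice c₃ hc₃ μ hμ)
    omega

/-- ★★ **`(SC)` FOR THE EQUAL PAIR-SUPPORTED LINES INSIDE THEIR 3-SPACE** — the profile `(ℂu, ℂu, V)` with `u ∈ V` supported on a
pair of letters (e.g. `u = x_ab`), `V` symmetric of `finrank 3`: `finrank W ≤ finrank ℂu + finrank ℂu + finrank V`.  (The pair-monomial
branch of the last open sub-case of `(1,1,3)`.) [folklore] -/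
theorem captureIneqSym_of_pairLine_mem_three (u : Fin 5 → Fin 5 → ℂ) (hu : ∀ p q, u p q = u q p) (hu0 : u ≠ 0)
    (a b c₁ c₂ c₃ : Fin 5) (hcov : ∀ x : Fin 5, x = a ∨ x = b ∨ x = c₁ ∨ x = c₂ ∨ x = c₃)
    (hc₁ : c₁ ≠ a ∧ c₁ ≠ b) (hc₂ : c₂ ≠ a ∧ c₂ ≠ b) (hc₃ : c₃ ≠ a ∧ c₃ ≠ b)
    (hsupp : ∀ p q, u p q ≠ 0 → (p = a ∨ p = b) ∧ (q = a ∨ q = b))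
    (V W : Submodule ℂ (Fin 5 → Fin 5 → ℂ)) (hV : ∀ x ∈ V, ∀ p q : Fin 5, x p q = x q p)
    (h3 : Module.finrank ℂ V = 3) (huV : u ∈ V)
    (hWs : ∀ μ ∈ W, ∀ s t : Fin 5, μ s t = μ t s) (hWd : ∀ μ ∈ W, ∀ s : Fin 5, μ s s = 0)
    (hWc : ∀ μ ∈ W, contractZ μ ∈ L3 (ℂ ∙ u) (ℂ ∙ u) V) :
    Module.finrank ℂ W ≤ Module.finrank ℂ (ℂ ∙ u) + Module.finrank ℂ (ℂ ∙ u) + Module.finrank ℂ V := by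
  have hle : (ℂ ∙ u) ≤ V := (Submodule.span_singleton_le_iff_mem u V).mpr huV
  have hXeq : (ℂ ∙ u) ⊔ (ℂ ∙ u) ⊔ V = V := by
    rw [sup_idem, sup_eq_right.mpr hle]
  have hX : Module.finrank ℂ ((ℂ ∙ u) ⊔ (ℂ ∙ u) ⊔ V : Submodule ℂ (Fin 5 → Fin 5 → ℂ)) ≤ 3 := by rw [hXeq, h3]
  have h01 : ∀ x ∈ (ℂ ∙ u), ∀ p q : Fin 5, x p q = x q p := by
    intro x hx p q
    obtain ⟨s, rfl⟩ := Submodule.mem_span_singleton.mp hx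
    simp only [Pi.smul_apply, smul_eq_mul, hu p q]
  have h := finrank_le_five_of_pairLine_flat u hu a b c₁ c₂ c₃ hcov hc₁ hc₂ hc₃ hsupp (ℂ ∙ u) V W h01 hV hX hWs hWd hWc
  rw [finrank_span_singleton hu0, h3]
  omega

end LaplaceFiveSeparatedCapture

end Summit.ValiantsHypothesis.ValiantsHypothesis.Theorems.RigidityForcesSymmetryRankRigidMinimalRepr
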